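import Literature.MathematicalPhysics.QuantumFieldTheory.Balaban1983to89.Node00.OpsYSectDCoords
import Literature.MathematicalPhysics.QuantumFieldTheory.Balaban1983to89.B9Thm312WholeIdentitiesSplit

/-!
# `Balaban1983to89.B9Thm312WholeIdentitiesDefAtPins` — [B9] Theorems 3.12–3.13 (pp. 420–426): the definitional ∕ resolvent part
# `IdentitiesDef` of the Sect.-D identity schema ASSEMBLED AT THE PINS from node00-def-Y's ten coordinate identities
# (`Node00.OpsYSectDCoords` §6–§7) — one bundled constructor for the knit

T. Bałaban, *Propagators for lattice gauge theories in a background field*, Commun. Math. Phys. **99** (1985) 389–434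
[`Balaban1985BackgroundPropagators`, "B9"].

statement-level skeleton of published theorems with citation tags; proofs where landed; nothing here is a claim about the Yang–Mills
mass gap

THE POINT.  `B9Thm312WholeIdentitiesSplit` splits the rows-20–21 schema `B9Thm312Whole.Identities 𝔬 U` into `IdentitiesDef 𝔬 U` (ten fields:
G₀Δ_a = I, (Δ_a − Δ′_π)G = I, (Δ_a − Δ′_π − Δ⁽²⁾_π)G₁ = I, (3.126), (3.129), (3.153), (QG₁Q\*)(QG₁Q\*)⁻¹ = I, Q\* ∕ D\* adjoint to Q ∕ D, R symmetric)
and `Ids3124 𝔬 U` (the (3.124) ∕ p. 425 constraint algebra — located gap O5, displayed).  node00-def-Y's `Node00.OpsYSectDCoords` (p551442)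
proves the ten, one by one, for EXPLICIT coordinate models of the letters (`S0coK TpicoK T2coK QcoKH QscoKH CcoK C1coK DvcoKH DvscoKH RcoK`,
n06-d's `GcoK ∕ HcoK` of def-Y's `GAY GDY G1Y GGY HDY H1Y`).  THIS FILE is the ≈ one-theorem sibling both seats deferred to *"whoever is
seated when both are in the tree"*: ★ `identitiesDef_of_pins` — for ANY letter record `𝔬 : B9Thm312Whole.Ops g B (XBK) Y (XHK) (XSK)`
(geometry, ∇-lattice `Y` and block maps free) whose sixteen operator letters at U₁ are PINNED to those models (hypotheses `hG0 … hR`),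
`IdentitiesDef 𝔬 U₁` holds under def-Y's displayed side conditions verbatim (`0 < N`; Δ_a, Δ_π,a, the (3.128) operator and QG₁Q\* units
at U₁; the configuration `G`-valued with `G ≤ U(N)` — unitary-valued, which serves the D ∕ D\* pair) — at the transporters `parSymY ∕
parBY ∕ GpY parSymY` of the record, over the trace basis `trBasis N`.  The knit then writes the `Identities` conjunct of its model binder as
`identities_of_def_3124 (identitiesDef_of_pins …) hIds3124` with `hIds3124 : Ids3124 …` displayed.

HONEST SCOPE.  Finite-dimensional bookkeeping — sixteen rewrites into ten landed identities; nothing of print is asserted; the three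
(3.124)-rows stay displayed (O5).  COUNT-NEUTRAL; N06 is NOT discharged; one finite lattice at a time; nothing continuum, nothing about the
mass gap.  Cell `pub-ymgap` (HUMAN RULING D-0062), Track A node N06 [B9], N06-ASSIGNMENT v1 rows 20–21 (bundle F7), seat
`pub-ymgap-dag-n06-l` (g11), 2026-08-27 (trigger t-IdDef of node00-def-Y g10).
-/

namespace Literature.MathematicalPhysics.QuantumFieldTheory.Balaban1983to89.B9Thm312WholeIdentitiesDefAtPins

open Literature.MathematicalPhysics.QuantumFieldTheory.Balaban1983to89
open Node00 Node00.OpsYSectDCoords B9Thm312Whole B9Thm312WholeIdentitiesSplit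
open B6KLevelCensusIndexV1 B9CoReadingCoords B9CoReadingCoordsH B9CoReadingCoordsS B9CoReadingCoordsTranspose B9Thm39ReadingCoords
open B9Eq3132SectDLetters
open scoped Matrix
open scoped Matrix.Norms.L2Operator

noncomputable section

variable {N : ℕ} {d ℓ : ℕ} {hd : 1 ≤ d + 1} {hL : Odd (ℓ + 1) ∧ 1 < ℓ + 1} {b₀ b₁ : ℝ}

/-- ★ **`IdentitiesDef` AT THE PINS** — the ten definitional ∕ resolvent Sect.-D identities (G₀Δ_a = I; (Δ_a − Δ′_π)G = I ((3.122)); (Δ_a − Δ′_π −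
Δ⁽²⁾_π)G₁ = I ((3.128)); H = GQ\*C ((3.126)); H₁ = G₁Q\*C₁ ((3.129)); 𝔊 = G₁𝔓\* ((3.153)); QG₁Q\*C₁ = I; Q\* adjoint to Q, D\* to D, R symmetric)
for any letter record whose operators at U₁ are node00-def-Y's coordinate models over the trace basis (hypotheses `hG0 … hR`), from
`Node00.OpsYSectDCoords` §6–§7 field by field, under its displayed side conditions (`0 < N`; the four units; the configuration `G`-valued,
`G ≤ U(N)` — hence unitary-valued, `B7Prop2Explicit.mem_unitaryUnits`, which serves `adjDv`). [cite: Balaban1985BackgroundPropagators, (3.120)–(3.130) pp.419–421 + (3.147) p.425 + (3.152)–(3.153) p.426] -/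
theorem identitiesDef_of_pins (i : KIdx d ℓ hd hL b₀ b₁) (B : B9.Backgrounds) (cfg : B.Cfg → CfgY (Matrix (Fin N) (Fin N) ℂ) i)
    (Δ2 : BondOpY (Matrix (Fin N) (Fin N) ℂ) i) {g : B9.Geometry} {Y : Type}
    (𝔬 : Ops g B (XBK (TrIdx N) i) Y (XHK (TrIdx N) i) (XSK (TrIdx N) i)) (U₁ : B.Cfg) (hN : 0 < N)
    {G : Subgroup (Matrix (Fin N) (Fin N) ℂ)ˣ} (hG : G ≤ B7Prop2Explicit.unitaryUnits (Matrix (Fin N) (Fin N) ℂ))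
    (hU : ∀ μ x, cfg U₁ μ x ∈ G)
    (hUa : IsUnit (deltaAY i (parSymY i) (parBY i) (GpY i (parSymY i)) (cfg U₁)))
    (hUπ : IsUnit (deltaPiAY i (parSymY i) (parBY i) (GpY i (parSymY i)) (cfg U₁)))
    (hU1 : IsUnit (deltaOneY i (parSymY i) (parBY i) (GpY i (parSymY i)) Δ2 (cfg U₁)))
    (hUQ : IsUnit (QGQOfY i (parBY i) (G1Y i (parSymY i) (parBY i) (GpY i (parSymY i)) Δ2) (cfg U₁)))
    (hG0 : 𝔬.G0 U₁ = GcoK i (trBasis N) B cfg (GAY i (parSymY i) (parBY i) (GpY i (parSymY i))) U₁)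
    (hS0 : 𝔬.S0 U₁ = S0coK i (trBasis N) B cfg (parSymY i) (parBY i) (GpY i (parSymY i)) U₁)
    (hTpi : 𝔬.Tpi U₁ = TpicoK i (trBasis N) B cfg (parSymY i) (GpY i (parSymY i)) U₁)
    (hT2 : 𝔬.T2 U₁ = T2coK i (trBasis N) B cfg (parSymY i) (GpY i (parSymY i)) Δ2 U₁)
    (hGD : 𝔬.G U₁ = GcoK i (trBasis N) B cfg (GDY i (parSymY i) (parBY i) (GpY i (parSymY i))) U₁)
    (hG1 : 𝔬.G1 U₁ = GcoK i (trBasis N) B cfg (G1Y i (parSymY i) (parBY i) (GpY i (parSymY i)) Δ2) U₁)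
    (hGG : 𝔬.GG U₁ = GcoK i (trBasis N) B cfg (GGY i (parSymY i) (parBY i) (GpY i (parSymY i)) Δ2) U₁)
    (hQ : 𝔬.Q U₁ = QcoKH i (trBasis N) B cfg (parBY i) U₁)
    (hQs : 𝔬.Qstar U₁ = QscoKH i (trBasis N) B cfg (parBY i) U₁)
    (hC : 𝔬.C U₁ = CcoK i (trBasis N) B cfg (parSymY i) (parBY i) (GpY i (parSymY i)) U₁)
    (hC1 : 𝔬.C1 U₁ = C1coK i (trBasis N) B cfg (parSymY i) (parBY i) (GpY i (parSymY i)) Δ2 U₁)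
    (hHm : 𝔬.Hm U₁ = HcoK i (trBasis N) B cfg (HDY i (parSymY i) (parBY i) (GpY i (parSymY i))) U₁)
    (hH1m : 𝔬.H1m U₁ = HcoK i (trBasis N) B cfg (H1Y i (parSymY i) (parBY i) (GpY i (parSymY i)) Δ2) U₁)
    (hDv : 𝔬.Dv U₁ = DvcoKH i (trBasis N) B cfg U₁)
    (hDvs : 𝔬.Dvstar U₁ = DvscoKH i (trBasis N) B cfg U₁)
    (hR : 𝔬.R U₁ = RcoK i (trBasis N) B cfg (parSymY i) (GpY i (parSymY i)) U₁) :
    IdentitiesDef 𝔬 U₁ := by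
  have hc : cR39 (trBasis N) ≠ 0 := (cR39_trBasis_pos hN).ne'
  have hUu : ∀ μ x, ((cfg U₁ μ x : (Matrix (Fin N) (Fin N) ℂ)ˣ) : Matrix (Fin N) (Fin N) ℂ) ∈ unitary (Matrix (Fin N) (Fin N) ℂ) :=
    fun μ x => B7Prop2Explicit.mem_unitaryUnits.mp (hG (hU μ x))
  refine
    { invG0' := ?_
      invG := ?_
      invG1 := ?_
      eq126 := ?_
      eq129 := ?_
      eq153 := ?_
      c1_inv := ?_
      adjQ := ?_
      adjDv := ?_
      symmR := ?_ }
  · rw [hG0, hS0]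
    exact GcoK_GAY_mul_S0coK hc hUa
  · rw [hS0, hTpi, hGD]
    exact S0coK_sub_TpicoK_mul_GcoK_GDY hc hUπ
  · rw [hS0, hTpi, hT2, hG1]
    exact S0coK_sub_mul_GcoK_G1Y hc hU1
  · rw [hHm, hGD, hQs, hC]
    exact HcoK_HDY_eq hc U₁
  · rw [hH1m, hG1, hQs, hC1]
    exact HcoK_H1Y_eq hc U₁
  · rw [frakPstar, hGG, hG1, hQs, hC1, hQ, hDv, hR, hDvs]
    exact GcoK_GGY_eq_frakPstar hc U₁
  · rw [hQ, hG1, hQs, hC1]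
    exact QcoKH_G1_Qs_C1_eq_id hc hUQ
  · rw [hQ, hQs]
    exact isTransposePair_QcoKH_QscoKH i B cfg U₁ hG hU
  · rw [hDv, hDvs]
    exact isTransposePair_DvcoKH_DvscoKH i B cfg U₁ hUu
  · rw [hR]
    exact isTransposePair_RcoK i B cfg U₁ hG hU

end

end Literature.MathematicalPhysics.QuantumFieldTheory.Balaban1983to89.B9Thm312WholeIdentitiesDefAtPins
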